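import Mathlib
import Summits.Ventures.HodgeRepro2.T5LocallyConstantDense

/-!
# T5MeasureSupOnClopens — the norm of an `𝒪`-valued measure is computed on indicators of clopen sets;
  it is unchanged by a unit-valued twist

Tier-5 support of seat p7 (route/T5-CHECK-G-p7.md §3 S4: «for a unit-valued continuous ν̃ and an
𝒪-valued measure m, {∫φ dm : φ ∈ C(Γ⁻, 𝒪)} = {∫φν̃ dm : φ ∈ C(Γ⁻, 𝒪)} ⇒ μ(ν̃·m) = μ(m), where
μ = inf over opens = inf over C(Γ⁻, 𝒪)»; route/T5-LEAN-p7.md §55).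

Model.  `X` profinite (the group `Γ⁻`), `R` a normed ring that is ultrametric and INTEGRAL —
`‖r‖ ≤ 1` for every `r` (`R = ℤ_p`, or the valuation ring of a finite extension; the value group
is not used) — and an «𝒪-valued measure» `m : C(X, R) →ₗ[R] R` that is bounded
(`‖m φ‖ ≤ C ‖φ‖`; for an `𝒪`-valued measure `C = 1`).  The μ-invariant of the prose is
`μ(m) = inf_U v(m(1_U)) = −log_p sup_U ‖m(1_U)‖`; this file works with the suprema of norms:

* `norm_apply_le_of_forall_indicator_le` — **«inf over opens = inf over C(Γ⁻, 𝒪)»**: if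
  `‖m(1_U)‖ ≤ S` for every clopen `U` then `‖m φ‖ ≤ S` for every continuous `φ` (density of the
  locally constant functions, T5LocallyConstantDense, + the ultrametric inequality);
* `sSup_allValues_eq_sSup_clopenValues` — the same as an equality of suprema;
* `allValues_twist` / `sSup_clopenValues_twist` — **«μ(ν̃·m) = μ(m)»**: for `ν` continuous with a
  continuous inverse (`ν * ν' = 1`), the twisted measure `φ ↦ m(νφ)` has the same set of values on
  `C(X, R)` (`φ ↦ νφ` is a bijection of `C(X, R)`), hence the same supremum on clopen indicators.

Nothing about Katz measures, p-adic L-functions or Iwasawa algebras is asserted: the measure is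
an abstract bounded functional.  Axioms: standard.  README §8(d): uses an L-value-free
non-vanishing device: NO.
-/

namespace Summit.Ventures.HodgeRepro2.T5MeasureSupOnClopens

open Set T5LocallyConstantDense

section Indicator

variable {X : Type*} [TopologicalSpace X] {R : Type*} [NormedRing R]

open Classical in
/-- The indicator of a clopen set as a continuous map (`0` for a set that is not clopen). -/
noncomputable def indicatorCM (U : Set X) : C(X, R) :=
  if hU : IsClopen U then
    (⟨U.indicator (fun _ => (1 : R)), isLocallyConstant_indicator hU 1⟩ :
      LocallyConstant X R).toContinuousMap
  else 0

/-- `indicatorCM U x = 1_U x` for clopen `U`. -/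
theorem indicatorCM_apply {U : Set X} (hU : IsClopen U) (x : X) :
    indicatorCM U x = U.indicator (1 : X → R) x := by
  simp only [indicatorCM, hU, dite_true]
  rfl

/-- `indicatorCM ∅ = 0`. -/
theorem indicatorCM_empty : (indicatorCM (∅ : Set X) : C(X, R)) = 0 := by
  ext x
  rw [indicatorCM_apply isClopen_empty]
  simp

/-- The values of an indicator have norm `≤ 1`. -/
theorem norm_indicatorCM_apply_le [NormOneClass R] (U : Set X) (x : X) :
    ‖(indicatorCM U : C(X, R)) x‖ ≤ 1 := by
  by_cases hU : IsClopen U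
  · rw [indicatorCM_apply hU]
    by_cases hx : x ∈ U
    · simp [indicator_of_mem hx]
    · simp [indicator_of_notMem hx]
  · simp [indicatorCM, hU]

variable [CompactSpace X]

/-- `‖1_U‖ ≤ 1` in the sup-norm. -/
theorem norm_indicatorCM_le [NormOneClass R] (U : Set X) : ‖(indicatorCM U : C(X, R))‖ ≤ 1 :=
  (ContinuousMap.norm_le _ zero_le_one).mpr (norm_indicatorCM_apply_le U)

/-- A locally constant `g` is `∑_{v ∈ range g} v • 1_{g⁻¹ v}` in `C(X, R)`
(T5LocallyConstantDense.eq_sum_indicator_fiber, read in `C(X, R)`). -/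
theorem toContinuousMap_eq_sum (g : LocallyConstant X R) :
    g.toContinuousMap = ∑ v ∈ g.range_finite.toFinset, v • (indicatorCM {z | g z = v} : C(X, R)) := by
  ext x
  rw [ContinuousMap.sum_apply, LocallyConstant.coe_continuousMap]
  conv_lhs => rw [eq_sum_indicator_fiber g x]
  refine Finset.sum_congr rfl fun v _ => ?_
  rw [ContinuousMap.smul_apply, indicatorCM_apply (isClopen_fiber g v), smul_eq_mul]

end Indicator

section Functional

variable {X : Type*} [TopologicalSpace X] {R : Type*} [NormedRing R]

/-- The values `‖m(1_U)‖` on clopen sets (`μ(m) = −log_p` of their supremum). -/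
def clopenValues (m : C(X, R) →ₗ[R] R) : Set ℝ :=
  {r | ∃ U : Set X, IsClopen U ∧ r = ‖m (indicatorCM U)‖}

/-- The values `‖m φ‖` on all continuous `φ`. -/
def allValues (m : C(X, R) →ₗ[R] R) : Set ℝ := {r | ∃ φ : C(X, R), r = ‖m φ‖}

/-- `0 ∈ clopenValues m` (`U = ∅`). -/
theorem zero_mem_clopenValues (m : C(X, R) →ₗ[R] R) : (0 : ℝ) ∈ clopenValues m :=
  ⟨∅, isClopen_empty, by rw [indicatorCM_empty, map_zero, norm_zero]⟩

/-- `clopenValues m ⊆ allValues m`. -/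
theorem clopenValues_subset_allValues (m : C(X, R) →ₗ[R] R) : clopenValues m ⊆ allValues m :=
  fun _ ⟨U, _, hr⟩ => ⟨indicatorCM U, hr⟩

/-- For a bounded `m` on an integral `R` (every `‖r‖ ≤ 1`, so `‖φ‖ ≤ 1`), `allValues m` is bounded
by `C`. -/
theorem bddAbove_allValues [CompactSpace X] (hR : ∀ r : R, ‖r‖ ≤ 1) (m : C(X, R) →ₗ[R] R) {C : ℝ}
    (hC : 0 ≤ C) (hm : ∀ φ, ‖m φ‖ ≤ C * ‖φ‖) : BddAbove (allValues m) := by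
  refine ⟨C, fun r ⟨φ, hr⟩ => ?_⟩
  rw [hr]
  calc ‖m φ‖ ≤ C * ‖φ‖ := hm φ
    _ ≤ C * 1 := by
        apply mul_le_mul_of_nonneg_left _ hC
        exact (ContinuousMap.norm_le _ zero_le_one).mpr fun x => hR (φ x)
    _ = C := mul_one C

/-- `clopenValues m` is bounded above (by the bound of `allValues m`). -/
theorem bddAbove_clopenValues [CompactSpace X] (hR : ∀ r : R, ‖r‖ ≤ 1) (m : C(X, R) →ₗ[R] R)
    {C : ℝ} (hC : 0 ≤ C) (hm : ∀ φ, ‖m φ‖ ≤ C * ‖φ‖) : BddAbove (clopenValues m) :=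
  (bddAbove_allValues hR m hC hm).mono (clopenValues_subset_allValues m)

/-- The ultrametric estimate on a locally constant function: `‖m g‖ ≤ S` when `‖m(1_U)‖ ≤ S` on
clopens and all values of `g` have norm `≤ 1`. -/
theorem norm_apply_toContinuousMap_le [CompactSpace X] [IsUltrametricDist R]
    (m : C(X, R) →ₗ[R] R) {S : ℝ} (hS : 0 ≤ S)
    (hbound : ∀ U : Set X, IsClopen U → ‖m (indicatorCM U)‖ ≤ S) (g : LocallyConstant X R)
    (hg : ∀ x, ‖g x‖ ≤ 1) : ‖m g.toContinuousMap‖ ≤ S := by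
  rw [toContinuousMap_eq_sum, map_sum]
  apply IsUltrametricDist.norm_sum_le_of_forall_le_of_nonneg hS
  intro v hv
  rw [map_smul, smul_eq_mul]
  obtain ⟨x, hx⟩ : v ∈ Set.range g := by simpa using hv
  calc ‖v * m (indicatorCM {z | g z = v})‖ ≤ ‖v‖ * ‖m (indicatorCM {z | g z = v})‖ := norm_mul_le _ _
    _ ≤ 1 * S := by
        apply mul_le_mul (hx ▸ hg x) (hbound _ (isClopen_fiber g v)) (norm_nonneg _) zero_le_one
    _ = S := one_mul S

variable [CompactSpace X] [T2Space X] [TotallyDisconnectedSpace X] [IsUltrametricDist R]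

/-- **«inf over opens = inf over C(Γ⁻, 𝒪)»**: if `‖m(1_U)‖ ≤ S` for every clopen `U`, then
`‖m φ‖ ≤ S` for every continuous `φ` — `φ` is within `ε` of a locally constant `g` (density), and
`‖m φ‖ ≤ max ‖m g‖ ‖m (φ − g)‖ ≤ max S (C ε)`. -/
theorem norm_apply_le_of_forall_indicator_le (hR : ∀ r : R, ‖r‖ ≤ 1) (m : C(X, R) →ₗ[R] R)
    {C : ℝ} (hC : 0 ≤ C) (hm : ∀ φ, ‖m φ‖ ≤ C * ‖φ‖) {S : ℝ} (hS : 0 ≤ S)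
    (hbound : ∀ U : Set X, IsClopen U → ‖m (indicatorCM U)‖ ≤ S) (φ : C(X, R)) : ‖m φ‖ ≤ S := by
  apply le_of_forall_pos_le_add
  intro ε hε
  have hε' : 0 < ε / (C + 1) := div_pos hε (by linarith)
  obtain ⟨g, hg⟩ := exists_locallyConstant_dist_lt φ hε'
  have hsub : ‖φ - g.toContinuousMap‖ ≤ ε / (C + 1) := by
    rw [ContinuousMap.norm_le _ hε'.le]
    intro x
    rw [ContinuousMap.sub_apply, LocallyConstant.coe_continuousMap, ← dist_eq_norm]
    exact (hg x).le
  have hφ : m φ = m g.toContinuousMap + m (φ - g.toContinuousMap) := by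
    rw [← map_add, add_sub_cancel]
  have h1 : ‖m g.toContinuousMap‖ ≤ S :=
    norm_apply_toContinuousMap_le m hS hbound g fun x => hR (g x)
  have h2 : ‖m (φ - g.toContinuousMap)‖ ≤ ε := by
    calc ‖m (φ - g.toContinuousMap)‖ ≤ C * ‖φ - g.toContinuousMap‖ := hm _
      _ ≤ C * (ε / (C + 1)) := mul_le_mul_of_nonneg_left hsub hC
      _ ≤ ε := by
          rw [mul_div_assoc', div_le_iff₀ (by linarith)]
          nlinarith
  rw [hφ]
  calc ‖m g.toContinuousMap + m (φ - g.toContinuousMap)‖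
      ≤ max ‖m g.toContinuousMap‖ ‖m (φ - g.toContinuousMap)‖ :=
        IsUltrametricDist.norm_add_le_max _ _
    _ ≤ S + ε := max_le (by linarith) (by linarith)

/-- **The supremum over all continuous functions equals the supremum over clopen indicators.** -/
theorem sSup_allValues_eq_sSup_clopenValues (hR : ∀ r : R, ‖r‖ ≤ 1) (m : C(X, R) →ₗ[R] R)
    {C : ℝ} (hC : 0 ≤ C) (hm : ∀ φ, ‖m φ‖ ≤ C * ‖φ‖) :
    sSup (allValues m) = sSup (clopenValues m) := by
  apply le_antisymm
  · have hne : (allValues m).Nonempty := ⟨‖m 0‖, 0, rfl⟩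
    apply csSup_le hne
    rintro r ⟨φ, rfl⟩
    have hS : 0 ≤ sSup (clopenValues m) :=
      le_csSup (bddAbove_clopenValues hR m hC hm) (zero_mem_clopenValues m)
    exact norm_apply_le_of_forall_indicator_le hR m hC hm hS
      (fun U hU => le_csSup (bddAbove_clopenValues hR m hC hm) ⟨U, hU, rfl⟩) φ
  · exact csSup_le_csSup (bddAbove_allValues hR m hC hm) ⟨0, zero_mem_clopenValues m⟩
      (clopenValues_subset_allValues m)

end Functional

section Twist

variable {X : Type*} [TopologicalSpace X] {R : Type*} [NormedCommRing R]

/-- The twisted measure `ν̃ · m : φ ↦ m (ν φ)`. -/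
def twist (ν : C(X, R)) (m : C(X, R) →ₗ[R] R) : C(X, R) →ₗ[R] R :=
  m ∘ₗ LinearMap.mulLeft R ν

/-- `twist ν m φ = m (ν * φ)`. -/
@[simp] theorem twist_apply (ν : C(X, R)) (m : C(X, R) →ₗ[R] R) (φ : C(X, R)) :
    twist ν m φ = m (ν * φ) := by
  simp only [twist, LinearMap.comp_apply, LinearMap.mulLeft_apply]

variable [CompactSpace X]

/-- The twisted measure is bounded by the same constant when `‖ν‖ ≤ 1` (automatic for integral `R`). -/
theorem twist_bound (hR : ∀ r : R, ‖r‖ ≤ 1) (ν : C(X, R)) (m : C(X, R) →ₗ[R] R) {C : ℝ}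
    (hC : 0 ≤ C) (hm : ∀ φ, ‖m φ‖ ≤ C * ‖φ‖) (φ : C(X, R)) : ‖twist ν m φ‖ ≤ C * ‖φ‖ := by
  rw [twist_apply]
  have hν : ‖ν‖ ≤ 1 := (ContinuousMap.norm_le _ zero_le_one).mpr fun x => hR (ν x)
  calc ‖m (ν * φ)‖ ≤ C * ‖ν * φ‖ := hm _
    _ ≤ C * (‖ν‖ * ‖φ‖) := mul_le_mul_of_nonneg_left (norm_mul_le _ _) hC
    _ ≤ C * (1 * ‖φ‖) := by
        apply mul_le_mul_of_nonneg_left _ hC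
        exact mul_le_mul_of_nonneg_right hν (norm_nonneg _)
    _ = C * ‖φ‖ := by rw [one_mul]

omit [CompactSpace X] in
/-- **«φ ↦ φν̃ is a bijection of C(Γ⁻, 𝒪)»**: for `ν` with a continuous inverse `ν'` (`ν * ν' = 1`)
the twisted measure takes the same values on `C(X, R)` as `m`. -/
theorem allValues_twist (ν ν' : C(X, R)) (hν : ν * ν' = 1) (m : C(X, R) →ₗ[R] R) :
    allValues (twist ν m) = allValues m := by
  ext r
  constructor
  · rintro ⟨φ, rfl⟩
    exact ⟨ν * φ, by rw [twist_apply]⟩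
  · rintro ⟨φ, rfl⟩
    refine ⟨ν' * φ, ?_⟩
    rw [twist_apply, ← mul_assoc, hν, one_mul]

variable [T2Space X] [TotallyDisconnectedSpace X] [IsUltrametricDist R]

/-- **«μ(ν̃·m) = μ(m)»** (S4): the supremum of `‖·‖` on clopen indicators is the same for `m` and
for its twist by a unit-valued continuous `ν` — through the common value `sSup (allValues _)`. -/
theorem sSup_clopenValues_twist (hR : ∀ r : R, ‖r‖ ≤ 1) (ν ν' : C(X, R)) (hν : ν * ν' = 1)
    (m : C(X, R) →ₗ[R] R) {C : ℝ} (hC : 0 ≤ C) (hm : ∀ φ, ‖m φ‖ ≤ C * ‖φ‖) :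
    sSup (clopenValues (twist ν m)) = sSup (clopenValues m) := by
  rw [← sSup_allValues_eq_sSup_clopenValues hR (twist ν m) hC (twist_bound hR ν m hC hm),
    allValues_twist ν ν' hν m, sSup_allValues_eq_sSup_clopenValues hR m hC hm]

end Twist

end Summit.Ventures.HodgeRepro2.T5MeasureSupOnClopens
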